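import Mathlib
import HarnessLib
import Summits.HubbardSuperconductivity.HubbardSuperconductivity.Theorems.KLProgrammeKLRegimeCountertermGateInduction

/-!
# Route `KLProgramme` — the Counterterm child of crux K3 (gen-3 item stmt-HubbardSuperconductivity-19825 `KLRegimeCountertermV11`):
# THE GATE INDUCTION UP TO A LEVEL (seat hubbard-kl-k3c3-p1, part H′ of the reading chain)

`…CountertermGateInduction` (part H) reads `|ν_j(K)(θ)| ≤ T j` at EVERY scale `j ≤ nScales β` from conditional sup bounds of all partial sums.
The intermediate frames `K^{(n)}` of the level recursion (`K^{(n)} = P^G K^{(n−1)} ⊖ D_n^G K^{(n−1)}`) are renormalised only UP TO THEIR OWN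
LEVEL `n`; this module is the same strong induction with the range capped at `n ≤ nScales β`:
`abs_klLocalPart_le_upTo_of_partialSums` and `renormalisedAtF_upTo_of_partialSums` (`T = tol`).  Proofs only.
-/

noncomputable section

namespace Summit.HubbardSuperconductivity.HubbardSuperconductivity.Theorems.KLRegimeSplit

set_option linter.dupNamespace false -- summit = problem name (single-conjunct summit), D-0017

open Real Finset
open Literature.MathematicalPhysics.QuantumLattice Literature.Probability.LatticeModels
open Summit.HubbardSuperconductivity.HubbardSuperconductivity.Theorems.KLProgrammeLegKernels

/-- **THE GATE INDUCTION UP TO A LEVEL `n ≤ nScales β`.**  As `abs_klLocalPart_le_all_of_partialSums`, with every `j ≤ nScales β` replaced by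
`j ≤ n`: the intermediate frames `K^{(n)}` of the level recursion are renormalised only up to their own level. -/
theorem abs_klLocalPart_le_upTo_of_partialSums (G : GeoConsts) (P : SplitConsts) (Q : EngConsts) (hG : G.WF) (hQ : Q.WF) :
    ∃ c₃ : ℝ, 0 < c₃ ∧ ∃ U₀ : ℝ, 0 < U₀ ∧ ∃ ΛK : ℝ, 0 ≤ ΛK ∧ ∃ r₀ : ℝ, 0 < r₀ ∧
      ∀ c : ℝ, 0 < c → c ≤ c₃ → ∀ U : ℝ, 0 < U → U ≤ U₀ → ∀ β : ℝ, klBetaMin ≤ β → β ≤ Real.exp (c / U ^ 2) →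
      ∀ μ ∈ klWindowC, ∀ (Lh : ℕ) (Mh : ℕ → ℕ), CtHypMsV11 G P Q β U μ Lh Mh →
      ∀ K : TrigPolyC4v, FrameOK (ctRenMs G) U (nScales β) μ K →
      ∀ (L M : ℕ) [NeZero L] [NeZero M], Lh ≤ L → Mh L ≤ M → (20 : ℝ) ≤ L → 8 * π / klFlatR ≤ L → 2 * π / L < r₀ →
      ∀ n ≤ nScales β, ∀ (B T : ℕ → ℝ),
        (∀ j ≤ n, (∀ i < j, RenormalisedAtF L M β U μ K (ctRenMs G) i) →
          ∀ q : Fin 2 → ℝ, |K.eval q + ∑ i ∈ range (j + 1), (klTwoLegPieceG L M β U μ K i).eval q| ≤ B j) →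
        (∀ j ≤ n, T j ≤ ctCr G * |U| * klScale klE0 j ^ 2 / klE0) →
        (∀ j ≤ n, B j + (4 / 3 * (G.S 1 + Q.S' 1 * |U|) * U ^ 2 * (2 * π / L) +
          (angBar G Q (ctRenMs G) U (nScales β) 1 + ΛK) * π * (2 * (π / L) / r₀)) ≤ T j) →
        ∀ j ≤ n, ∀ θ : ℝ, |klLocalPart L M β U μ K j θ| ≤ T j := by
  have hR : ∀ j, 0 ≤ (ctRenMs G).Gfr j := ctRenMs_Gfr_nonneg hG
  obtain ⟨c₃, hc₃, U₀, hU₀, ΛK, hΛK, r₀, hr₀, hgate⟩ := abs_klLocalPart_le_of_partialSum_frameOK (ctRenMs G) hR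
  refine ⟨c₃, hc₃, U₀, hU₀, ΛK, hΛK, r₀, hr₀, ?_⟩
  intro c hc hcle U hU hUle β hβmin hβc μ hμ Lh Mh hyp K hK L M _ _ hLh hMh hL20 hLflat hLu n hn B T hB hT htol
  have hS1 : 0 ≤ G.S 1 + Q.S' 1 * |U| := by
    have hS : ∀ j, 0 ≤ G.S j := hG.2.2.2.2.2.2.2.2.2.2.2.2.2.2.2.2.2.1
    have hS' : ∀ j, 0 ≤ Q.S' j := hQ.2.2.2.2.1
    have := hS 1; have := hS' 1; positivity
  have hRWF : (ctRenMs G).WF := (ctRenMs_WF2 hG).1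
  have hang0 : 0 ≤ angBar G Q (ctRenMs G) U (nScales β) 1 := angBar_nonneg hG hQ hRWF U (nScales β) 1
  -- strong induction on the scale
  intro j
  induction j using Nat.strong_induction_on with
  | _ j ih =>
    intro hj θ
    -- renormalisation below `j` (induction hypothesis + `T ≤ tol`)
    have hren : ∀ i < j, RenormalisedAtF L M β U μ K (ctRenMs G) i := fun i hi θ' =>
      (ih i hi (le_of_lt (lt_of_lt_of_le hi hj)) θ').trans (hT i (le_of_lt (lt_of_lt_of_le hi hj)))
    -- the slots at the scales `≤ j`
    have hsizes : ∀ i ≤ j, TwoLegSizesG L M G Q (ctRenMs G) β U μ K i := fun i hi =>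
      (hyp.twoLegStepG hK hLh hMh (hi.trans (hj.trans hn)) fun i' hi' => hren i' (lt_of_lt_of_le hi' hi)).1
    have hang : TwoLegAngularG L M G Q (ctRenMs G) β U μ K j := hyp.twoLegAngularG hK hLh hMh (hj.trans hn) hren
    -- the reading at `θ`
    have hread := hgate c hc hcle U hU hUle β hβmin hβc μ hμ K hK L M hL20 hLflat hLu j
      (angBar G Q (ctRenMs G) U (nScales β) 1) hang0 (fun a b => hang.abs_sub_le a b)
      (∑ i ∈ range (j + 1), twoLegBar G Q U 1 i) (sum_nonneg fun i _ => by rw [twoLegBar_one_eq]; positivity)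
      (abs_partialSum_sub_le_of_sizes L M hsizes) θ
    have hBj := hB j hj hren (klFermiPoint μ K θ)
    have hΛℓ : (∑ i ∈ range (j + 1), twoLegBar G Q U 1 i) * (2 * π / L) ≤
        4 / 3 * (G.S 1 + Q.S' 1 * |U|) * U ^ 2 * (2 * π / L) := by
      have hLpos : (0 : ℝ) < L := by linarith
      exact mul_le_mul_of_nonneg_right (sum_twoLegBar_one_le G Q U hS1 _) (by positivity)
    have := htol j hj
    linarith


/-- **Renormalisation up to level `n`** from conditional sup bounds of the partial sums `j ≤ n` (`T = tol`). -/
theorem renormalisedAtF_upTo_of_partialSums (G : GeoConsts) (P : SplitConsts) (Q : EngConsts) (hG : G.WF) (hQ : Q.WF) :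
    ∃ c₃ : ℝ, 0 < c₃ ∧ ∃ U₀ : ℝ, 0 < U₀ ∧ ∃ ΛK : ℝ, 0 ≤ ΛK ∧ ∃ r₀ : ℝ, 0 < r₀ ∧
      ∀ c : ℝ, 0 < c → c ≤ c₃ → ∀ U : ℝ, 0 < U → U ≤ U₀ → ∀ β : ℝ, klBetaMin ≤ β → β ≤ Real.exp (c / U ^ 2) →
      ∀ μ ∈ klWindowC, ∀ (Lh : ℕ) (Mh : ℕ → ℕ), CtHypMsV11 G P Q β U μ Lh Mh →
      ∀ K : TrigPolyC4v, FrameOK (ctRenMs G) U (nScales β) μ K →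
      ∀ (L M : ℕ) [NeZero L] [NeZero M], Lh ≤ L → Mh L ≤ M → (20 : ℝ) ≤ L → 8 * π / klFlatR ≤ L → 2 * π / L < r₀ →
      ∀ n ≤ nScales β, ∀ B : ℕ → ℝ,
        (∀ j ≤ n, (∀ i < j, RenormalisedAtF L M β U μ K (ctRenMs G) i) →
          ∀ q : Fin 2 → ℝ, |K.eval q + ∑ i ∈ range (j + 1), (klTwoLegPieceG L M β U μ K i).eval q| ≤ B j) →
        (∀ j ≤ n, B j + (4 / 3 * (G.S 1 + Q.S' 1 * |U|) * U ^ 2 * (2 * π / L) +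
          (angBar G Q (ctRenMs G) U (nScales β) 1 + ΛK) * π * (2 * (π / L) / r₀)) ≤ ctCr G * |U| * klScale klE0 j ^ 2 / klE0) →
        ∀ j ≤ n, RenormalisedAtF L M β U μ K (ctRenMs G) j := by
  obtain ⟨c₃, hc₃, U₀, hU₀, ΛK, hΛK, r₀, hr₀, h⟩ := abs_klLocalPart_le_upTo_of_partialSums G P Q hG hQ
  refine ⟨c₃, hc₃, U₀, hU₀, ΛK, hΛK, r₀, hr₀, ?_⟩
  intro c hc hcle U hU hUle β hβmin hβc μ hμ Lh Mh hyp K hK L M _ _ hLh hMh hL20 hLflat hLu n hn B hB htol j hj θ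
  exact h c hc hcle U hU hUle β hβmin hβc μ hμ Lh Mh hyp K hK L M hLh hMh hL20 hLflat hLu n hn B
    (fun j => ctCr G * |U| * klScale klE0 j ^ 2 / klE0) hB (fun j _ => le_rfl) htol j hj θ

end Summit.HubbardSuperconductivity.HubbardSuperconductivity.Theorems.KLRegimeSplit

end
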